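import Summits.Ventures.DiscreteObjects.PP12.OrderThirteenShapeFacts
import Summits.Ventures.DiscreteObjects.PP12.OrderThirteenTiles
import Summits.Ventures.DiscreteObjects.PP12.OrderThirteenTranspose

/-!
# PP(12), order-13 cell: the cells of VALID lift data in the language of the kernel search (shapes, classes, packable tiles)
Framing: lottery ticket; floor = certified bounds/negative ranges.

Cell pub-namedobj (venture DiscreteObjects), target (M), designs gen 20 (CERT-P13-DESIGN §1, lemmas L1–L5 in the kernel's vocabulary).
For valid `D : LiftData N 13` (`OrderThirteenCollineation.LiftData.Valid`) and a nonempty cell `E_{s,t}` (mask `D.cmask s t`):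
* L1 `shape_spec` / `cell_eq_image` / `sizeOf_gsh`: the cell is the translate by `D.gof s t` of the canonical shape `D.gsh s t < 27`, whose size class
  is `om s t` (row partition ⇒ `0 ∉ E`; internal uniqueness ⇒ distinct differences ⇒ `Shape13.shape_table`);
* L2/L3 `row_compat` / `col_compat`: two nonempty cells of one row, or of one column, have non-conflicting shapes (`Shape13.confl`), by internal
  uniqueness, resp. `col_internal_unique` (`OrderThirteenTranspose`);
* L4/L5 `row_pack` / `col_pack`: for two rows (columns) and distinct shared columns (rows) whose two cells are nonempty and not both singletons, the
  canonical tiles `tmask (tid (g+1) (g'+1))` are PACKABLE (`Shape13.PackP 0`): the cross-difference sets (`OrderThirteenTiles.crossDiff`) are the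
  witnessing placement (translates of the tiles, pairwise disjoint, avoiding `0`); columns by `valid_transpose`.
No `sorry`, no new axioms; nothing here asserts a census statement.
-/

namespace Summit.Ventures.DiscreteObjects.PP12

namespace LiftData

open Finset Shape13

variable {N : ℕ}

/-- the 13-bit mask of the cell `E_{s,t}` -/
def cmask (D : LiftData N 13) (s t : Fin N) : ℕ := maskOf (D.cell s t)

/-- the canonical SHAPE id of the cell `E_{s,t}` -/
def gsh (D : LiftData N 13) (s t : Fin N) : ℕ := shapeIdOf (D.cmask s t)

/-- the translation of the cell `E_{s,t}` relative to its shape -/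
def gof (D : LiftData N 13) (s t : Fin N) : ℕ := offOf (D.cmask s t)

/-- the cell mask is 13-bit -/
theorem cmask_lt (D : LiftData N 13) (s t : Fin N) : D.cmask s t < 8192 := maskOf_lt _

/-- the bits of the cell mask are the membership table -/
theorem testBit_cmask (D : LiftData N 13) (s t : Fin N) (x : Fin 13) : (D.cmask s t).testBit x = D.mem s t x := by
  unfold cmask
  cases h : D.mem s t x
  · cases h' : (maskOf (D.cell s t)).testBit x
    · rfl
    · have := (testBit_maskOf_val _ x).1 h'
      rw [mem_cell, h] at this; exact absurd this (by simp)
  · exact (testBit_maskOf_val _ x).2 (by rw [mem_cell, h])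

/-- the cells of the transpose -/
theorem cell_transpose (D : LiftData N 13) (s t : Fin N) : D.transpose.cell s t = D.cell t s := rfl

/-- the cell masks of the transpose -/
theorem cmask_transpose (D : LiftData N 13) (s t : Fin N) : D.transpose.cmask s t = D.cmask t s := rfl

/-- the shapes of the transpose -/
theorem gsh_transpose (D : LiftData N 13) (s t : Fin N) : D.transpose.gsh s t = D.gsh t s := rfl

/-- a nonempty cell has a nonzero mask -/
theorem cmask_ne_zero (D : LiftData N 13) {s t : Fin N} (h1 : 1 ≤ D.om s t) : D.cmask s t ≠ 0 := by
  intro h0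
  obtain ⟨x, hx⟩ := Finset.card_pos.1 (show 0 < (D.cell s t).card from h1)
  have := (testBit_maskOf_val (D.cell s t) x).2 hx
  unfold cmask at h0
  rw [h0, Nat.zero_testBit] at this
  exact Bool.false_ne_true this

section valid

variable (D : LiftData N 13) (hV : D.Valid)
include hV

/-- (M·U): residue `0` is in no cell -/
theorem cmask_bit_zero (s t : Fin N) : bit (D.cmask s t) 0 = false := by
  rw [bit_eq, show (0 : ℕ) = ((0 : Fin 13) : ℕ) from rfl, testBit_cmask]
  exact (hV.1 s).1.1 t

/-- (U·U): the internal differences of a cell are pairwise distinct -/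
theorem cmask_ddOK (s t : Fin N) : ddOK (D.cmask s t) = true := by
  apply ddOK_of (D.cmask_lt s t)
  intro d hd1 hd2 a ha a' ha' h1 h2 h3 h4
  -- read the four bits as memberships and apply internal uniqueness with `δ = d`
  have key : ∀ b : ℕ, ∀ hb : b < 13, (D.cmask s t).testBit b = true → (D.cmask s t).testBit ((b + 13 - d) % 13) = true →
      D.mem s t ⟨b, hb⟩ = true ∧ D.mem s t (⟨b, hb⟩ - ⟨d, by omega⟩) = true := by
    intro b hb e1 e2
    refine ⟨by rwa [← testBit_cmask], ?_⟩
    have e : ((⟨b, hb⟩ - ⟨d, by omega⟩ : Fin 13) : ℕ) = (b + 13 - d) % 13 := by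
      rw [Fin.sub_def]; dsimp only; congr 1; omega
    rw [← testBit_cmask, e]; exact e2
  obtain ⟨m1, m2⟩ := key a ha h1 h2
  obtain ⟨m3, m4⟩ := key a' ha' h3 h4
  have hδ : (⟨d, by omega⟩ : Fin 13) ≠ 0 := by
    intro e; have := congrArg Fin.val e; simp at this; omega
  obtain ⟨t₀, x₀, -, -, huniq⟩ := (hV.1 s).2 ⟨d, by omega⟩ hδ
  have e1 := huniq t ⟨a, ha⟩ m1 m2
  have e2 := huniq t ⟨a', ha'⟩ m3 m4
  have := e1.2.trans e2.2.symm
  exact congrArg Fin.val this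

/-- **L1 — every nonempty cell is a translate of exactly one canonical shape**: `cmask = rot13 (shm gsh) gof` with `gsh < 27`, `gof < 13` -/
theorem shape_spec {s t : Fin N} (h1 : 1 ≤ D.om s t) :
    D.gsh s t < 27 ∧ D.gof s t < 13 ∧ rot13 (shm (D.gsh s t)) (D.gof s t) = D.cmask s t :=
  shape_table (D.cmask_lt s t) (D.cmask_ne_zero h1) (D.cmask_bit_zero hV s t) (D.cmask_ddOK hV s t)

/-- L1 at the level of sets: `E_{s,t} = gof + S_{gsh}` -/
theorem cell_eq_image {s t : Fin N} (h1 : 1 ≤ D.om s t) :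
    D.cell s t = (setOf (shm (D.gsh s t))).image fun a => (⟨D.gof s t, (D.shape_spec hV h1).2.1⟩ : Fin 13) + a := by
  apply maskOf_injective
  rw [maskOf_image_add, maskOf_setOf (shm_facts (D.shape_spec hV h1).1).1]
  exact (D.shape_spec hV h1).2.2.symm

/-- L1, sizes: the size class of the shape is the orbit-matrix entry -/
theorem sizeOf_gsh {s t : Fin N} (h1 : 1 ≤ D.om s t) : Shape13.sizeOf (D.gsh s t) = D.om s t := by
  rw [← (shm_facts (D.shape_spec hV h1).1).2.1]
  unfold om
  rw [D.cell_eq_image hV h1, card_image_of_injective _ (fun a b h => add_left_cancel h)]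

/-- the true shape is one of the candidates of its size -/
theorem gsh_mem_idsOfSize {s t : Fin N} (h1 : 1 ≤ D.om s t) : D.gsh s t ∈ idsOfSize (D.om s t) := by
  have h := (shm_facts (D.shape_spec hV h1).1).2.2.2.2
  rwa [D.sizeOf_gsh hV h1] at h

/-- membership of a shape element, translated, in the cell -/
theorem mem_of_shm_bit {s t : Fin N} (h1 : 1 ≤ D.om s t) {a : ℕ} (ha : a < 13) (hbit : (shm (D.gsh s t)).testBit a = true) :
    D.mem s t ((⟨D.gof s t, (D.shape_spec hV h1).2.1⟩ : Fin 13) + ⟨a, ha⟩) = true := by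
  rw [← mem_cell, D.cell_eq_image hV h1, mem_image]
  exact ⟨⟨a, ha⟩, (mem_setOf _ _).2 hbit, rfl⟩

/-- **L2 — two nonempty cells of one ROW have non-conflicting shapes** (a common difference class would be an internal difference realised twice) -/
theorem row_compat {s t t' : Fin N} (htt : t ≠ t') (h1 : 1 ≤ D.om s t) (h1' : 1 ≤ D.om s t') :
    bit (confl (D.gsh s t)) (D.gsh s t') = false := by
  by_contra hc
  rw [Bool.not_eq_false] at hc
  obtain ⟨ha, hb, ha', hb', hab, b1, b2, b3, b4, e⟩ := confl_witness (D.shape_spec hV h1).1 (D.shape_spec hV h1').1 hc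
  -- `x + a, x + b` lie in the first cell, `x' + a', x' + b'` in the second, and `a − b = a' − b'`
  set x : Fin 13 := ⟨D.gof s t, (D.shape_spec hV h1).2.1⟩
  set x' : Fin 13 := ⟨D.gof s t', (D.shape_spec hV h1').2.1⟩
  set a : Fin 13 := ⟨cw (D.gsh s t) (D.gsh s t') 0, ha⟩
  set b : Fin 13 := ⟨cw (D.gsh s t) (D.gsh s t') 1, hb⟩
  set a' : Fin 13 := ⟨cw (D.gsh s t) (D.gsh s t') 2, ha'⟩
  set b' : Fin 13 := ⟨cw (D.gsh s t) (D.gsh s t') 3, hb'⟩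
  have m1 : D.mem _ _ (x + a) = true := D.mem_of_shm_bit hV h1 ha b1
  have m2 : D.mem _ _ (x + b) = true := D.mem_of_shm_bit hV h1 hb b2
  have m3 : D.mem _ _ (x' + a') = true := D.mem_of_shm_bit hV h1' ha' b3
  have m4 : D.mem _ _ (x' + b') = true := D.mem_of_shm_bit hV h1' hb' b4
  have hab' : a + b' = a' + b := by
    apply Fin.ext; rw [Fin.val_add, Fin.val_add]; exact e
  set δ : Fin 13 := (x + a) - (x + b) with hδ
  have hδ0 : δ ≠ 0 := by
    intro h0
    rw [hδ, sub_eq_zero, add_right_inj, Fin.ext_iff] at h0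
    exact hab h0
  have eδ : (x' + a') - δ = x' + b' := by
    rw [hδ, add_sub_add_left_eq_sub]
    calc x' + a' - (a - b) = x' + (a' + b) - a := by abel
      _ = x' + (a + b') - a := by rw [hab']
      _ = x' + b' := by abel
  obtain ⟨t₀, x₀, -, -, huniq⟩ := (hV.1 s).2 δ hδ0
  have e1 := huniq t (x + a) m1 (by rw [hδ, sub_sub_cancel]; exact m2)
  have e2 := huniq t' (x' + a') m3 (by rw [eδ]; exact m4)
  exact htt (e1.1.trans e2.1.symm)

/-- **L3 — two nonempty cells of one COLUMN have non-conflicting shapes** (a common difference class would be a cross difference realised twice) -/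
theorem col_compat {s s' t : Fin N} (hss : s ≠ s') (h1 : 1 ≤ D.om s t) (h1' : 1 ≤ D.om s' t) :
    bit (confl (D.gsh s t)) (D.gsh s' t) = false := by
  by_contra hc
  rw [Bool.not_eq_false] at hc
  obtain ⟨ha, hb, ha', hb', hab, b1, b2, b3, b4, e⟩ := confl_witness (D.shape_spec hV h1).1 (D.shape_spec hV h1').1 hc
  -- `x + a, x + b` lie in the first cell, `x' + a', x' + b'` in the second, and `a − b = a' − b'`
  set x : Fin 13 := ⟨D.gof s t, (D.shape_spec hV h1).2.1⟩
  set x' : Fin 13 := ⟨D.gof s' t, (D.shape_spec hV h1').2.1⟩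
  set a : Fin 13 := ⟨cw (D.gsh s t) (D.gsh s' t) 0, ha⟩
  set b : Fin 13 := ⟨cw (D.gsh s t) (D.gsh s' t) 1, hb⟩
  set a' : Fin 13 := ⟨cw (D.gsh s t) (D.gsh s' t) 2, ha'⟩
  set b' : Fin 13 := ⟨cw (D.gsh s t) (D.gsh s' t) 3, hb'⟩
  have m1 : D.mem _ _ (x + a) = true := D.mem_of_shm_bit hV h1 ha b1
  have m2 : D.mem _ _ (x + b) = true := D.mem_of_shm_bit hV h1 hb b2
  have m3 : D.mem _ _ (x' + a') = true := D.mem_of_shm_bit hV h1' ha' b3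
  have m4 : D.mem _ _ (x' + b') = true := D.mem_of_shm_bit hV h1' hb' b4
  have hab' : a + b' = a' + b := by
    apply Fin.ext; rw [Fin.val_add, Fin.val_add]; exact e
  set δ : Fin 13 := (x + a) - (x + b) with hδ
  have hδ0 : δ ≠ 0 := by
    intro h0
    rw [hδ, sub_eq_zero, add_right_inj, Fin.ext_iff] at h0
    exact hab h0
  have eδ : (x' + a') - δ = x' + b' := by
    rw [hδ, add_sub_add_left_eq_sub]
    calc x' + a' - (a - b) = x' + (a' + b) - a := by abel
      _ = x' + (a + b') - a := by rw [hab']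
      _ = x' + b' := by abel
  have k := D.col_internal_unique hV hδ0 m1 (by rw [hδ, sub_sub_cancel]; exact m2) m3 (by rw [eδ]; exact m4)
  exact hss k.1.symm

/-- the cross-difference set of a column of a row pair is a translate of the canonical tile of the two shapes -/
theorem maskOf_crossDiff {s s' : Fin N} (t : Fin N) (h1 : 1 ≤ D.om s t) (h1' : 1 ≤ D.om s' t) (h2 : 2 ≤ D.om s t * D.om s' t) :
    ∃ c < 13, maskOf (D.crossDiff s s' t) = rot13 (tmask (tid (D.gsh s t + 1) (D.gsh s' t + 1))) c := by
  have hg := (D.shape_spec hV h1).1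
  have hg' := (D.shape_spec hV h1').1
  obtain ⟨-, -, hz, hrot⟩ := tile_facts (a := D.gsh s t + 1) (b := D.gsh s' t + 1) (by omega) (by omega)
  have hne : tid (D.gsh s t + 1) (D.gsh s' t + 1) ≠ 0 := by
    rw [Ne, hz]
    rintro (h | h | ⟨ha, hb⟩)
    · omega
    · omega
    · -- both singletons: sizes 1 · 1 < 2
      have e1 : D.gsh s t = 0 := by omega
      have e2 : D.gsh s' t = 0 := by omega
      have hs := D.sizeOf_gsh hV h1
      have hs' := D.sizeOf_gsh hV h1'
      rw [e1] at hs; rw [e2] at hs'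
      have hs0 : Shape13.sizeOf 0 = 1 := by decide
      rw [← hs, ← hs', hs0] at h2
      exact absurd h2 (by norm_num)
  obtain ⟨htoff, htm⟩ := hrot hne
  simp only [Nat.add_sub_cancel] at htm
  -- the cross-difference set is `(x − y) + (S_g − S_g')`
  have hcd := D.crossDiff_of_translate (D.cell_eq_image hV h1) (D.cell_eq_image hV h1')
  set x : Fin 13 := ⟨D.gof s t, (D.shape_spec hV h1).2.1⟩
  set y : Fin 13 := ⟨D.gof s' t, (D.shape_spec hV h1').2.1⟩
  have hm : maskOf (D.crossDiff s s' t) = rot13 (diffMask (shm (D.gsh s t)) (shm (D.gsh s' t))) ((x - y : Fin 13) : ℕ) := by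
    rw [hcd, maskOf_image_add, maskOf_image₂_sub, maskOf_setOf (shm_facts hg).1, maskOf_setOf (shm_facts hg').1]
  -- re-base the rotation on the canonical tile
  set v : ℕ := ((x - y : Fin 13) : ℕ) with hv
  have hv13 : v < 13 := (x - y).isLt
  refine ⟨(v + 13 - toff (D.gsh s t + 1) (D.gsh s' t + 1)) % 13, Nat.mod_lt _ (by norm_num), ?_⟩
  rw [hm, htm, rot13_rot13 (diffMask_lt _ _) (Nat.le_of_lt htoff) (Nat.le_of_lt (Nat.mod_lt _ (by norm_num)))]
  congr 1
  omega

/-- **L4 — the canonical tiles of a ROW pair over distinct shared columns are packable** (cells nonempty, not both singletons) -/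
theorem row_pack {s s' : Fin N} (hss : s ≠ s') (ts : List (Fin N)) (hnd : ts.Nodup)
    (hts : ∀ t ∈ ts, 1 ≤ D.om s t ∧ 1 ≤ D.om s' t ∧ 2 ≤ D.om s t * D.om s' t) :
    PackP 0 (ts.map fun t => tmask (tid (D.gsh s t + 1) (D.gsh s' t + 1))) := by
  refine ⟨ts.map fun t => (tmask (tid (D.gsh s t + 1) (D.gsh s' t + 1)), maskOf (D.crossDiff s s' t)), by simp [List.map_map],
    fun p hp => ?_, fun p hp => ?_, ?_⟩
  · obtain ⟨t, ht, rfl⟩ := List.mem_map.1 hp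
    obtain ⟨h1, h1', h2⟩ := hts t ht
    exact D.maskOf_crossDiff hV t h1 h1' h2
  · obtain ⟨t, ht, rfl⟩ := List.mem_map.1 hp
    dsimp only
    apply Nat.eq_of_testBit_eq
    intro i
    rw [land_def, lor_def, Nat.testBit_land, Nat.testBit_lor, Nat.zero_testBit, Bool.false_or]
    cases i with
    | zero => rw [testBit_maskOf_zero (D.zero_not_mem_crossDiff hV hss t)]; rfl
    | succ i =>
      cases h1 : Nat.testBit 1 (i + 1)
      · rw [Bool.and_false]
      · exact absurd (Nat.testBit_one_eq_true_iff_self_eq_zero.1 h1) (Nat.succ_ne_zero i)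
  · rw [List.pairwise_map]
    exact List.Pairwise.imp (fun {t t'} htt => land_maskOf_eq_zero (D.crossDiff_disjoint hV hss htt)) hnd

/-- **L5 — the canonical tiles of a COLUMN pair over distinct shared rows are packable** (by duality) -/
theorem col_pack {t t' : Fin N} (htt : t ≠ t') (ss : List (Fin N)) (hnd : ss.Nodup)
    (hss : ∀ s ∈ ss, 1 ≤ D.om s t ∧ 1 ≤ D.om s t' ∧ 2 ≤ D.om s t * D.om s t') :
    PackP 0 (ss.map fun s => tmask (tid (D.gsh s t + 1) (D.gsh s t' + 1))) :=
  D.transpose.row_pack (D.valid_transpose hV (by norm_num)) htt ss hnd (fun s hs => hss s hs)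

end valid

end LiftData

end Summit.Ventures.DiscreteObjects.PP12
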